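import Mathlib
import HarnessLib
import HarnessLib.Audit
import Summits.AtomisticToContinuum.Statement
import Summits.AtomisticToContinuum.BoseEinsteinCondensation.Theorems.BECRenormGroupAssembly
import Literature.MathematicalPhysics.QuantumManyBody.PeriodicBoseGas
import HarnessLib.Audit.Status.Attr

/-!
Route: BECInfraredBound

X_B1 (ZERO-MODE MACROSCOPIC OCCUPATION; formal, item BecZeroModeThesis): for every repulsive
finite-range radial v there is
ρ₀ > 0 such that for all 0 < ρ < ρ₀ there is c > 0 with: for all large N there is δ > 0 such that
EVERY admissible
Dirichlet trial state Ψ in the box of side L = (N/ρ)^{1/3} with energy ≤ E₀(N,L) + δ has occupation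
of the normalised
constant mode φ₀ = L^{-3/2}·1_{Λ_L} at least c·N:  ⟨φ₀, γ_Ψ φ₀⟩ ≥ cN.  Since ⟨φ₀, γ_Ψ φ₀⟩ ≤
λ_max(γ_Ψ) ≤ condensateNumber
uniformly over δ-near-minimisers, X_B1 ⇒ BoseEinsteinCondensation (item Assembly, PROVED:
bec_of_zeroMode).
THE LINE (Dyson–Lieb–Simon / Kennedy–Lieb–Shastry mode counting made Dirichlet-native, pointwise in
v): X_B1 follows from
(i) a T = 0 INFRARED BOUND on the occupations of the INNER-BOX plane waves φ'_k = L'^{-3/2}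
e^{2πik·x/L'} 1_{Λ'},
Λ' = (εL, L−εL)³, L' = (1−2ε)L, in the infrared window 0 < ‖k‖ ≤ K√ρ·L:  ⟨φ'_k, γ_Ψ φ'_k⟩ ≤ C(1 +
√ρ·L/‖k‖)
(Bogoliubov/Gavoret–Nozières shape √(πρa)·L'/(2π|k|) + O(1); crux BecIrWindow, for v not a.e. 0,
i.e. a(v) > 0);
(ii) a summed ULTRAVIOLET TAIL Σ_{‖k‖ > K√ρ·L} ⟨φ'_k, γ_Ψ φ'_k⟩ ≤ θN with θ < 1 (crux BecUvTail);
(iii) no boundary accumulation, N_shell ≤ CεN (crux BecShellMass); then d = 3 lattice-point counting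
in the window,
the tsum split window ⊔ tail, and Parseval on Λ' with the shell transfer φ₀ = (1−2ε)^{3/2}φ'_0 + w
(cruxes BecWindowCount →
BecDepletionSplit → BecDepletionCounting, pointwise in v) give ⟨φ₀, γ_Ψ φ₀⟩ ≥ cN at small ρ;
(iv) the free gas (v a.e. 0 on (0,∞)) is settled separately by the spectral gap of the Dirichlet
Laplacian (crux BecFreeGas).
KINDS (crux-only deciding theorem, ruling 2026-08-16): every unproved hypothesis of `closes` is a
crux until it is proved
(BecShellMass and the four draft-phase lemmas were re-badged support → crux on 2026-08-16; each is
discharged inside `closes`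
via its `_holds` theorem when it lands, shrinking the hypothesis list towards closes : BecIrWindow →
BoseEinsteinCondensation).
Edge to the target by name (support BecZeroModeOfCruxes): BecIrWindow → BecUvTail → BecShellMass →
BecZeroModeThesis.
Deciding theorem (pure logic + Assembly_holds): closes : BecIrWindow → BecUvTail → BecShellMass →
BecWindowCount →
BecDepletionSplit → BecDepletionCounting → BecFreeGas → BoseEinsteinCondensation.
Lean: ∀ v : ℝ → ℝ≥0∞, Literature.MathematicalPhysics.QuantumManyBody.BoseGas.IsRepulsiveFiniteRange
v → ∃ ρ₀ : ℝ, 0 < ρ₀ ∧ ∀ ρ : ℝ, 0 < ρ → ρ < ρ₀ → ∃ c : ℝ, 0 < c ∧ ∀ᶠ N : ℕ in Filter.atTop, ∃ δ :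
ℝ≥0∞, 0 < δ ∧ ∀ Ψ : Literature.MathematicalPhysics.QuantumManyBody.BoseGas.TrialState N
(Literature.MathematicalPhysics.QuantumManyBody.BoseGas.sideLength ρ N),
Literature.MathematicalPhysics.QuantumManyBody.BoseGas.energy v Ψ ≤
Literature.MathematicalPhysics.QuantumManyBody.BoseGas.groundStateEnergy v N
(Literature.MathematicalPhysics.QuantumManyBody.BoseGas.sideLength ρ N) + δ → ENNReal.ofReal (c * N)
≤ Literature.MathematicalPhysics.QuantumManyBody.BoseGas.occupation N
((Literature.MathematicalPhysics.QuantumManyBody.BoseGas.box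
(Literature.MathematicalPhysics.QuantumManyBody.BoseGas.sideLength ρ N)).indicator fun _ =>
((Real.sqrt (Literature.MathematicalPhysics.QuantumManyBody.BoseGas.sideLength ρ N ^ 3))⁻¹ : ℂ)) Ψ.ψ

Rationale: WHY THIS LINE. The only proofs of BEC for genuinely interacting bosons in a thermodynamic limit are
for reflection-positive
LATTICE models (hard-core bosons at half filling = XY model: DysonLiebSimon1978, KLS1988PRL), where
Gaussian domination gives an
INFRARED (upper) BOUND n(p) ≲ 1/ε(p) and BEC follows from a sum rule by mode counting in d ≥ 3. The
continuum Bose gas is not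
reflection positive, so the dictionary is explicit and partial: [lattice RP / Gaussian domination] ↦
[an a-priori upper bound on
inner-box plane-wave occupations of Dirichlet energy near-minimisers, filed AS the crux]; [sum rule]
↦ [Parseval in L²(Λ')];
[d ≥ 3 infrared integrability of 1/p²] ↦ [lattice-point counting of Σ_{0<‖k‖≤K√ρL} (1 + √ρL/‖k‖) =
O(K³√ρ·N + K²√ρ·N), small at
small density — exactly why the conjunct is stated for ρ < ρ₀(v)]. What replaces RP above the window
is the modern second-order
energy technology (FournaisSolovej2020 = arXiv:1904.06164, FournaisSolovej2022 = arXiv:2108.12022,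
Fournais2020 = arXiv:2011.00309:
LHY by localisation to boxes ≫ healing length with excitation-number control; BEC on scales ℓ ≪
ρ^{-1/2}(ρa³)^{-η}). The missing step
from "BEC in every mesoscopic box" to X_B1 is phase coherence across boxes = the infrared window;
the high-momentum remainder is only
asked in summed form with a constant θ < 1. Inner-box plane waves with k ≠ 0 are exactly orthogonal
to 1_{Λ'}, so the Dirichlet wall
layer (which loads full-box axis modes with ≳ 0.15 L/a particles, refuters on stmt-0689) does not
leak into the bound. The torus
analogue of the whole counting half is PROVED in tree (route BECGroundStateSOS,
Theorems.IRModeCounting_proof), and the free Dirichlet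
gas condenses in the conjunct's exact sense (Literature hasGroundStateBEC_zero). Areas imported:
RP/infrared bounds (lattice statistical
mechanics), many-body variational localisation (LHY programme), elementary geometry of numbers.

RANKED CRUXES. Seven = the cap, by the crux-only rule for deciding theorems (human ruling
2026-08-16): 2 analytic cruxes + 1
localisation estimate + 4 draft-phase lemmas that are hypotheses of `closes` and therefore cruxes
until proved (re-badged support →
crux on 2026-08-16, kind.auto-crux semantics; each is discharged inside `closes` by its `_holds`
theorem when it lands — this is ONE
thesis, not two). All seven are refuter/grounder-stamped.
 #2 BecIrWindow — T = 0 infrared bound, window form: for v not a.e. 0 on (0,∞), every ε ∈ (0,1/4)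
and K > 0 there are ρ₀, C such
    that every δ-near-minimiser (all large N, some δ > 0) has ⟨φ'_k, γ_Ψ φ'_k⟩ ≤ C(1 + √ρ·L/‖k‖) for
all k ∈ ℤ³∖0 with ‖k‖ ≤ K√ρ·L
    (why it might fail: N-uniformity at the lowest modes needs the exact T = 0 law n_p ≈ mc/2|p|
(Gavoret–Nozières) with no log L
    beyond Bogoliubov order, plus control of the sharp-window smearing; no continuum IR bound
without reflection positivity is
    known; sources: DysonLiebSimon1978, KLS1988PRL, GavoretNozieres1964, LSSY2005 Ch. 11). OPEN —
the bet; the route's one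
    research-level obstruction (rattack-8911, rreview1, grounders g26-5/g26-9 concur).
 #3 BecUvTail — summed ultraviolet tail Σ_{‖k‖ > K√ρ·L} ⟨φ'_k, γ_Ψ φ'_k⟩ ≤ θN, θ < 1 (why it might
fail: unprinted; two refuter
    derivations make it provable now — first-order IBP Fourier tail for C¹ slices on [0,L'] with
non-zero traces + Bessel/Tonelli +
    E₀ ≤ 8πaρN for Dirichlet near-minimisers (in tree: eventually_groundStateEnergy_le_dyson) —
modulo the trace term being O(N/K)
    uniformly in ε and a(v) < ∞; sources: LSSY2005, Fournais2020, Junge2026, EVIDENCE_BecUvTail.md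
on stmt-8823).
 #4 BecShellMass — no boundary accumulation N_shell ≤ CεN, C before ε, ρ₀(ε) (why: LY98 cell lower
bound — in tree,
    LSSY2005_lowerBound_dirichlet_holds / LSSY2005_cellDecomposition_holds — run on shell and bulk
separately with Neumann bracketing
    across ∂Λ', against the Dyson upper bound; convexity forces N_shell/N ≤ 6ε + o_ρ(1); unprinted
in this form; wall-cut cells and
    hard cores are the risks; sources: LiebYngvason1998, LSSY2005 Thm 2.2/2.4).
 #9 BecWindowCount (piece 1/3: window IR bound for v ⇒ window mass ≤ ηN by the sup-norm lattice
count (2⌊R⌋+1)³ and Σ1/‖k‖∞ ≤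
    13R(R+1), R = K√ρL; arithmetic verified by refuters g41-27/g41-12; formal risk only), #9
BecDepletionSplit (piece 2/3: window count
    + UV tail ⇒ Σ'_{k≠0} ≤ θ'N, ENNReal tsum over window ⊔ tail subtypes; formal risk only), #9
BecDepletionCounting (piece 3/3:
    Parseval on the translated inner cube for `occupation` — 3-D Fourier ONB after affine transport,
torus analogue
    tsum_sq_cellFourierCoeff in tree — plus the seminorm shell transfer ⟨w,γw⟩ ≤ 6ε·N_shell ⇒ X_B1
for v; DLS sum rule, true on paper,
    Lean-heavy), #9 BecFreeGas (v a.e. 0 on (0,∞) ⇒ X_B1 for v: energy v = energy 0 since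
pair-distance preimages of null sets are
    null, then the free Dirichlet gas, gap 3π²/L², φ₀-share (8/π²)³ ⇒ c = 1/4; shared with three
other routes; in tree only
    HasGroundStateBEC 0 ρ via sub-cell modes). Sources for the four: LSSY2005 Ch. 5/11,
DysonLiebSimon1978.
 Target #0 BecZeroModeThesis (X_B1; derived from the seven by the by_cases logic of `closes`).
Assembly #1 (X_B1 → conjunct) is
 PROVED (bec_of_zeroMode_rg). Support #9 BecZeroModeOfCruxes (stmt-14463): the edge BecIrWindow →
BecUvTail → BecShellMass →
 BecZeroModeThesis by name — pure logic from the four #9 cruxes once they are proved; prove last.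
 DEAD / SUPERSEDED items still rendered (support, do not claim; every drop bounces
route.multi-assembly while the second assembly item
 Assembly2 = stmt-0688 stays attached, and the gate lets no seat drop or re-kind an assembly item —
OPERATOR: detach/close stmt-0688,
 whose body is the type of `closes`, then drop these): BecInfraredBound 0689 (full-box form, wall
layer), BecIrBoundInner 0733 (false
 as typed: v ≡ 0, sharp-window k⁻⁴), BecIrImpliesZeroMode 0690 and BecIrInnerImpliesZeroMode 0735
(idle/vacuous implications),
 BecFournaisLengthScales 0691 (= the proved Literature fact Fournais2020_condensation),
BecZeroModeGlue 14181 (blocked TODO record).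

KILL CRITERIA. A proof that for some admissible v with a(v) > 0 and all small ρ the Dirichlet
near-minimisers violate the window
bound at ‖k‖ = 1 by a divergent factor (log L or stronger phase fluctuations) refutes BecIrWindow
and closes the route (not the
conjunct); note `closes` consumes BecIrWindow only through the SUMMED window mass ≤ ηN
(BecWindowCount), so a pointwise refutation
that leaves the window sum o(N)-small is class misstated → restate BecIrWindow in summed form. A
refutation of BecUvTail by a
sharp-window artefact (boundary-flux tail ≥ (1−o(1))N for every K) would be class misstated → smooth
window (mollified 1_{Λ'}); a
refutation by genuine bulk physics (almost all mass above K/ξ for every K) contradicts the LHY-order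
excitation bounds and would close
the route. A refutation of any #9 crux is misstated by construction (formal corner: N = 0, θ ≤ 0, a
= ⊤) → restate, never close.
¬X_B1 with BEC true would mean condensation into a mode asymptotically orthogonal to φ₀ — excluded
heuristically (healing length ≪ L,
BecShellMass); if a refuter proves ¬BecZeroModeThesis the line pivots to the "∃ mode" form of the
target with the same cruxes.

NOT DECOMPOSED YET. How to prove BecIrWindow (an Onsager-type kinetic/potential trade-off at low
momenta — a T = 0 substitute for
Gaussian domination — or a coherence estimate between neighbouring mesoscopic condensates);
BecUvTail's refuter recipe is a proof
plan, not a split. Periodic-vs-Dirichlet comparison at LHY precision is NOT needed anywhere (only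
leading order enters, through
BecShellMass and the slack δ); positive temperature is out of scope. After the four #9 cruxes and
BecUvTail/BecShellMass land, the
planner rewrites `closes` to `fun hIr => …_holds …` so that the route reads closes : BecIrWindow →
BoseEinsteinCondensation.

CHEAPEST FALSIFIER. Evaluate both analytic crux inequalities in closed form on the two states where
everything is explicit, before
any many-body work: (i) the free Dirichlet ground state ∏ sin(πx_j/L) (v ≡ 0): BecUvTail must and
does hold (tail → 0), BecIrWindow
is exempt by hypothesis and indeed fails there (inner mode e₁ carries c(ε)N, c ≈ 0.059 → 0.021 for ε
∈ (0, 1/8], independent of L,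
≫ C√ρL) — any restatement that re-admits v ≡ 0 is dead; (ii) the Bogoliubov quasi-free state of the
box at density ρ, whose
inner-box occupations are an explicit lattice sum (n_p smeared by the sharp-window Fejér kernel): a
log L excess over C(1 + √ρL/‖k‖)
at ‖k‖ = 1, or a window-boundary flux tail exceeding θN uniformly in K, kills the corresponding crux
(rattack-8911's small model gives
n'(k) ≤ A(ε)·√ρL/‖k‖∞, no log).

SOURCES. DysonLiebSimon1978; KLS1988PRL; LSSY2005 §1.2, Ch. 2, Ch. 5, Ch. 11; LiebYngvason1998;
FournaisSolovej2020
(arXiv:1904.06164); FournaisSolovej2022 (arXiv:2108.12022); Fournais2020 (arXiv:2011.00309);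
Junge2026 (arXiv:2603.20776);
ChongLiangNam2026 (arXiv:2510.20493); BoccatoEtAl2019Acta; GavoretNozieres1964;
NepomnyashchiiNepomnyashchii1978;
PitaevskiiStringari1991; PenroseOnsager1956.

Novelty: Searches (2026-08-15, this seat): `lit search --hybrid "infrared bound momentum distribution
interacting Bose gas zero temperature upper bound
occupation 1/p"` (12 textbook hits: Griffin–Snoke–Stringari 1995, Pethick–Smith, Di Castro–Raimondi
…, no rigorous continuum IR bound);
`lit search --source crossref "Gaussian domination infrared bound quantum continuum boson"`
(doi:10.1016/j.physleta.2013.08.045 Sankovich2013,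
lattice GD; doi:10.1215/00127094-2023-0064 Sellke 2024, GD for the polaron); `lit search --source
crossref "Bogoliubov theory Gross-Pitaevskii
limit …"` (doi:10.4310/acta.2019.v222.n2.a1 BoccatoEtAl2019Acta, doi:10.1007/s00220-019-03555-9,
doi:10.1017/fms.2022.78 — mode-resolved
Bogoliubov theory incl. ⟨a*_pa_p⟩ but only in the GP regime L ~ (ρa)^(-1/2)); `lit frontier
AtomisticToContinuum --since 2022` (30 rows; BEC
descendants arXiv:2510.20493 ChongLiangNam2026, arXiv:2603.20776 Junge2026 — localisation/Poincaré
methods, condensate totals n₊ only, scales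
≤ a(ρa³)^(-3/4-η)); `lit galaxy search "infrared bound" --star all` (24 rows: Friedli–Velenik,
LSSY2005, Dario–Wu Villain arXiv:2002.02946 —
classical/lattice RP only); `lit galaxy search "momentum distribution of the dilute Bose gas" --star
all` (0); arXiv / zbMATH / OpenAlex / S2
APIs rate-limited (HTTP 429) in this session; `ledger negatives --problem AtomisticToContinuum` (1,
unrelated); grounder/refuter page evidence
on items 0686/0733/0734 (LSSY2005 pp. 8, 16, 19–20, 23–24, 35, 117–124; arXiv:2011.00309  [refs: 10.1016/j.physleta.2013.08.045, 10.1215/00127094-2023-0064, 10.4310/acta.2019.v222.n2.a1, 10.1007/s00220-019-03555-9, 10.1017/fms.2022.78, 2510.20493, 2603.20776, 2002.02946, 2011.00309, doi:10.1016/j.physleta.2013.08.045, doi:10.1215/00127094-2023-0064, doi:10.4310/acta.2019.v222.n2.a1, doi:10.1007/s00220-019-03555-9, doi:10.1017/fms.2022.78, Sankovich2013, ChongLiangNam2026, Junge2026, LSSY2005,]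

Barriers (technique_class: infrared-bound, sum-rule, inner-box, Dirichlet-native): - technique_class: infrared-bound, sum-rule, inner-box, Dirichlet-native
- Literature.Barriers.AtomisticToContinuum.HalfFillingReflectionPositivity: it does not evade it;
the bet is explicit — the IR bound is filed AS THE CRUX (BecIrWindow) with no reflection positivity,
half filling or particle–hole symmetry available in the continuum; everything downstream of the IR
bound (sum rule, d = 3 counting) is symmetry-free (DLS1978 §1) and is what this route makes formal
for the Dirichlet box.
- Literature.Barriers.AtomisticToContinuum.BogoliubovPerturbationInfrared: applies to BecIrWindow at
the lowest modes — T = 0 expansions around Bogoliubov are log-divergent in d = 3 (Gavoret–Nozières,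
Nepomnyashchii); the crux asks only for the ORDER √(ρa)/|p| with a v-dependent constant and a '+1'
floor, which the exact GN asymptotics (n_p → n₀mc/2|p|) respect; a genuine log L at |p| = 2π/L would
refute the crux (Kill criteria), so the barrier is priced in, not evaded.
- Literature.Barriers.AtomisticToContinuum.KineticGapLengthScales: applies to BecUvTail's intended
proof — gap/localisation methods control depletion only on boxes ≲ a(ρa³)^(-3/4-η); evaded in
statement by asking above the window ‖k‖ > K√ρL (momenta ≳ K/ξ, i.e. exactly the healing-length
physics those methods own) and only for a θN bound, never o(N) at thermodynamic scale; the
thermodynamic-scale coherence is isolated in BecIrWindow.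
- Literature.Barriers.AtomisticToContinuum.EnergyAsymptoticsWithoutCondensation: energy asympt

History (route lifecycle, newest last):
- 2026-08-16T14:43:06Z · LINT AUTOFIX route.multi-assembly: kept Assembly, dropped Assembly2 (gate:hygiene)

sub-problem: BoseEinsteinCondensation · status: draft · opened planner-AtomisticToContinuum-Survey-0 2026-08-13T13:25:24Z · rev 18 · ledger route-AtomisticToContinuum-BECInfraredBound
GENERATED by the gate from the ledger (D-0016/17). Provers cite these decls: `theorem foo : Summit.AtomisticToContinuum.BoseEinsteinCondensation.Theses.BECInfraredBound.<Decl> := …` in Summits/AtomisticToContinuum/BoseEinsteinCondensation/Theorems/<Name>.lean.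
-/

namespace Summit.AtomisticToContinuum.BoseEinsteinCondensation.Theses.BECInfraredBound

open scoped BigOperators Topology Manifold Classical MeasureTheory ProbabilityTheory Matrix InnerProductSpace ComplexConjugate ContinuousMap Real NNReal ENNReal
open Filter Set Function TopologicalSpace MeasureTheory

attribute [summit_statement] _root_.BoseEinsteinCondensation

/-- item stmt-AtomisticToContinuum-0686 · target · rank 0 · open · by planner
why it might fail: It is thermodynamic-limit BEC itself in zero-mode Dirichlet form (LSSY2005 (5.2), 'open after 75 years'), stronger than the conjunct (constant mode, all δ-near-minimisers); fails if Dirichlet near-minimisers condense into a mode asymptotically orthogonal to φ₀.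
sources: LSSY2005, PenroseOnsager1956, Fournais2020
X_B1: zero-mode macroscopic occupation. For every repulsive finite-range v, at all small densities
ρ, for all large N there is δ > 0 such that every δ-near-minimiser Ψ of the Dirichlet N-body energy
in the box of side (N/ρ)^{1/3} has ⟨φ₀, γ_Ψ φ₀⟩ ≥ cN for the normalised constant mode φ₀ =
L^{-3/2}·1_box (c > 0 depending on v, ρ). -/
@[route_item "route-AtomisticToContinuum-BECInfraredBound"]
def BecZeroModeThesis : Prop :=
  ∀ v : ℝ → ENNReal, Literature.MathematicalPhysics.QuantumManyBody.BoseGas.IsRepulsiveFiniteRange v → ∃ ρ₀ : ℝ, 0 < ρ₀ ∧ ∀ ρ : ℝ, 0 < ρ → ρ < ρ₀ → ∃ c : ℝ, 0 < c ∧ ∀ᶠ N : ℕ in Filter.atTop, ∃ δ : ENNReal, 0 < δ ∧ ∀ Ψ : Literature.MathematicalPhysics.QuantumManyBody.BoseGas.TrialState N (Literature.MathematicalPhysics.QuantumManyBody.BoseGas.sideLength ρ N), Literature.MathematicalPhysics.QuantumManyBody.BoseGas.energy v Ψ ≤ Literature.MathematicalPhysics.QuantumManyBody.BoseGas.groundStateEnergy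 v N (Literature.MathematicalPhysics.QuantumManyBody.BoseGas.sideLength ρ N) + δ → ENNReal.ofReal (c * N) ≤ Literature.MathematicalPhysics.QuantumManyBody.BoseGas.occupation N ((Literature.MathematicalPhysics.QuantumManyBody.BoseGas.box (Literature.MathematicalPhysics.QuantumManyBody.BoseGas.sideLength ρ N)).indicator fun _ => ((Real.sqrt (Literature.MathematicalPhysics.QuantumManyBody.BoseGas.sideLength ρ N ^ 3))⁻¹ : ℂ)) Ψ.ψ

/-- item stmt-AtomisticToContinuum-8911 · crux · rank 2 · open · by planner
why it might fail: N-uniformity at the lowest modes needs the exact T=0 law n_p ≈ mc/2|p| (Gavoret–Nozières) with no log L beyond Bogoliubov order, plus control of the sharp-window smearing √ρL·log‖k‖/‖k‖²; no continuum IR bound without reflection positivity is known (LSSY2005 §11.1).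
sources: DysonLiebSimon1978, KLS1988PRL, LSSY2005, GavoretNozieres1964, NepomnyashchiiNepomnyashchii1978, PitaevskiiStringari1991
[crux] T = 0 INFRARED BOUND, WINDOW FORM (replaces stmt-0733): for every repulsive finite-range v
that is not a.e. zero on (0,∞) (⇔ scattering length a(v) > 0), every ε ∈ (0,1/4) and every K > 0
there are ρ₀, C > 0 (depending on v, ε, K) such that for 0 < ρ < ρ₀, all large N, some δ > 0 and
every δ-near-minimiser Ψ of the Dirichlet energy in the box of side L = (N/ρ)^(1/3): every inner-box
plane wave φ'_k = L'^(-3/2) e^(2πik·x/L') 1_Λ' (Λ' = (εL, L−εL)³, L' = (1−2ε)L, k ∈ ℤ³∖0, sup norm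
‖k‖) in the infrared window ‖k‖ ≤ K√ρ·L has occupation ⟨φ'_k, γ_Ψ φ'_k⟩ ≤ C(1 + √ρ·L/‖k‖).
Bogoliubov/Gavoret–Nozières value √(πρa)·L'/(2π|k|) + O(1) ('+1' = quantum floor; window momenta
2πK√ρ/(1−2ε) ≪ 1/a once ρ₀(K) is small; sharp-window correction O(√ρ·L·log‖k‖/‖k‖²) is inside the
bound). Continuum T = 0 analogue of the DLS/KLS infrared bound; OPEN. [difficulty: open-problem]
(why it might fail: N-uniformity at the lowest modes needs the exact T=0 law n_p ≈ mc/2|p|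
(Gavoret–Nozières) with no log L beyond Bogoliubov order and control of the sharp-window correction
√ρL·log‖k‖/‖k‖²; no continuum IR bound without reflection positivity is known.) [sources:
DysonLiebSimon1978, KLS1988PRL, LSSY2005, Ga -/
@[route_item "route-AtomisticToContinuum-BECInfraredBound", crux]
def BecIrWindow : Prop :=
  ∀ v : ℝ → ENNReal, Literature.MathematicalPhysics.QuantumManyBody.BoseGas.IsRepulsiveFiniteRange v → ¬ (∀ᵐ r ∂(MeasureTheory.volume.restrict (Set.Ioi (0 : ℝ))), v r = 0) → ∀ ε : ℝ, 0 < ε → ε < 1 / 4 → ∀ K : ℝ, 0 < K → ∃ ρ₀ : ℝ, 0 < ρ₀ ∧ ∃ C : ℝ, 0 < C ∧ ∀ ρ : ℝ, 0 < ρ → ρ < ρ₀ → ∀ᶠ N : ℕ in Filter.atTop, ∃ δ : ENNReal, 0 < δ ∧ ∀ Ψ : Literature.MathematicalPhysics.QuantumManyBody.BoseGas.TrialState N (Literature.MathematicalPhysics.QuantumManyBody.BoseGas.sideLength ρ N), Literature.MathematicalPhysics.QuantumManyBody.BoseGas.energy v Ψ ≤ Literature.MathematicalPhysics.QuantumManyBody.BoseGas.groundStateEnergy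 v N (Literature.MathematicalPhysics.QuantumManyBody.BoseGas.sideLength ρ N) + δ → ∀ k : Fin 3 → ℤ, k ≠ 0 → ‖(fun j => (k j : ℝ))‖ ≤ K * Real.sqrt ρ * Literature.MathematicalPhysics.QuantumManyBody.BoseGas.sideLength ρ N → Literature.MathematicalPhysics.QuantumManyBody.BoseGas.occupation N ({x : EuclideanSpace ℝ (Fin 3) | ∀ j, x j ∈ Set.Ioo (ε * Literature.MathematicalPhysics.QuantumManyBody.BoseGas.sideLength ρ N) (Literature.MathematicalPhysics.QuantumManyBody.BoseGas.sideLength ρ N - ε * Literature.MathematicalPhysics.QuantumManyBody.BoseGas.sideLength ρ N)}.indicator fun x => ((Real.sqrt (((1 - 2 * ε) * Literature.MathematicalPhysics.QuantumManyBody.BoseGas.sideLength ρ N) ^ 3))⁻¹ : ℂ) * Complex.exp (Complex.I * ↑(2 * Real.pi / ((1 - 2 * ε) * Literature.MathematicalPhysics.QuantumManyBody.BoseGas.sideLength ρ N) * ∑ j, (k j : ℝ) * x j))) Ψ.ψ ≤ ENNReal.ofReal (C * (1 + Real.sqrt ρ * Literature.MathematicalPhysics.QuantumManyBody.BoseGas.sideLength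 ρ N / ‖(fun j => (k j : ℝ))‖))

/-- item stmt-AtomisticToContinuum-8823 · crux · rank 3 · closed · proved by Summit.AtomisticToContinuum.BoseEinsteinCondensation.Theorems.BecUvTail_proof @ 0cf7eeee60e1 (prover) · by planner
why it might fail: Unprinted; refuters derive it (IBP tail lemma for C¹ slices on [0,L′] with non-zero traces + Bessel/Tonelli + E₀ ≤ 8πaρN for Dirichlet near-minimisers): fails only if the trace term 8L′‖g‖‖g′‖/(π²K√ρL) is not O(N/K) uniformly in ε, or for a(v) = ⊤ (hard core) where E₀ ≤ CρN needs a < ∞.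
sources: LSSY2005, Fournais2020, Junge2026, refuter evidence EVIDENCE_BecUvTail.md on stmt-AtomisticToContinuum-8823, Literature.MathematicalPhysics.QuantumManyBody.BoseGas.eventually_groundStateEnergy_le_dyson
[crux] ULTRAVIOLET TAIL (new; the summed second half refuter g24-0 asked for): for every repulsive
finite-range v there are K > 0 and θ < 1 such that for every ε ∈ (0,1/4) there is ρ₀ > 0 with: for 0
< ρ < ρ₀, all large N, some δ > 0 and every δ-near-minimiser Ψ (Dirichlet, L = (N/ρ)^(1/3)), the
summed occupation of the inner-box plane waves φ'_k beyond the infrared window, Σ_{‖k‖ > K√ρ·L}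
⟨φ'_k, γ_Ψ φ'_k⟩ (tsum over the subtype), is ≤ θN — 'not almost every particle of Λ' sits at momenta
above K/ξ'. Bogoliubov: the tail is the k⁻⁴ depletion O(√(ρa³)N) plus a sharp-window boundary-flux
tail ≤ (depletion)/(2π²K); free gas (v ≡ 0): → 0, so no non-triviality hypothesis. The ultraviolet
half, where energy localisation lives. [difficulty: L] (why it might fail: Kinetic Chebyshev is
unavailable: Σ‖k‖²⟨φ'_k,γφ'_k⟩ = ∞ for the sharp window 1_Λ' (boundary flux, refuter g24-0 on 0733);
so the tail needs mesoscopic condensation (Fournais2020/Junge2026) patched over healing-length boxes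
by a momentum-localisation inequality, unprinted; hard cores allowed.) [sources: Fournais2020,
FournaisSolovej2020, FournaisSolovej2022, Junge2026, ChongLiangNam2026, LSSY2005,
Literature.Barriers.AtomisticToCo -/
@[route_item "route-AtomisticToContinuum-BECInfraredBound", crux]
def BecUvTail : Prop :=
  ∀ v : ℝ → ENNReal, Literature.MathematicalPhysics.QuantumManyBody.BoseGas.IsRepulsiveFiniteRange v → ∃ K : ℝ, 0 < K ∧ ∃ θ : ℝ, θ < 1 ∧ ∀ ε : ℝ, 0 < ε → ε < 1 / 4 → ∃ ρ₀ : ℝ, 0 < ρ₀ ∧ ∀ ρ : ℝ, 0 < ρ → ρ < ρ₀ → ∀ᶠ N : ℕ in Filter.atTop, ∃ δ : ENNReal, 0 < δ ∧ ∀ Ψ : Literature.MathematicalPhysics.QuantumManyBody.BoseGas.TrialState N (Literature.MathematicalPhysics.QuantumManyBody.BoseGas.sideLength ρ N), Literature.MathematicalPhysics.QuantumManyBody.BoseGas.energy v Ψ ≤ Literature.MathematicalPhysics.QuantumManyBody.BoseGas.groundStateEnergy v N (Literature.MathematicalPhysics.QuantumManyBody.BoseGas.sideLength ρ N) + δ →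 ∑' k : {k : Fin 3 → ℤ // K * Real.sqrt ρ * Literature.MathematicalPhysics.QuantumManyBody.BoseGas.sideLength ρ N < ‖(fun j => (k j : ℝ))‖}, Literature.MathematicalPhysics.QuantumManyBody.BoseGas.occupation N ({x : EuclideanSpace ℝ (Fin 3) | ∀ j, x j ∈ Set.Ioo (ε * Literature.MathematicalPhysics.QuantumManyBody.BoseGas.sideLength ρ N) (Literature.MathematicalPhysics.QuantumManyBody.BoseGas.sideLength ρ N - ε * Literature.MathematicalPhysics.QuantumManyBody.BoseGas.sideLength ρ N)}.indicator fun x => ((Real.sqrt (((1 - 2 * ε) * Literature.MathematicalPhysics.QuantumManyBody.BoseGas.sideLength ρ N) ^ 3))⁻¹ : ℂ) * Complex.exp (Complex.I * ↑(2 * Real.pi / ((1 - 2 * ε) * Literature.MathematicalPhysics.QuantumManyBody.BoseGas.sideLength ρ N) * ∑ j, ((k : Fin 3 → ℤ) j : ℝ) * x j))) Ψ.ψ ≤ ENNReal.ofReal (θ * N)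

/-- item stmt-AtomisticToContinuum-0734 · crux · rank 4 · closed · proved by Summit.AtomisticToContinuum.BoseEinsteinCondensation.Theorems.becShellMass_proof @ 32a68c5db652 (prover) · by planner
why it might fail: ∃C before ∀ε, ρ₀ = ρ₀(ε): needs the LY98 cell lower bound run on shell and bulk separately (Neumann bracketing across ∂Λ′, wall-cut cells) against E₀ ≤ 4πaρN(1+o(1)) for Dirichlet near-minimisers; unprinted in this form; fails if bracketing at ∂Λ′ costs O(ρaN), or for hard cores (a = ⊤).
sources: LiebYngvason1998, LSSY2005, Literature.MathematicalPhysics.QuantumManyBody.BoseGas.LSSY2005_lowerBound_dirichlet_holds, Literature.MathematicalPhysics.QuantumManyBody.BoseGas.LSSY2005_cellDecomposition_holds, Literature.MathematicalPhysics.QuantumManyBody.BoseGas.eventually_groundStateEnergy_le_dyson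
NO BOUNDARY ACCUMULATION (new crux; feeds the inner-box mode counting): for every repulsive
finite-range v there is C such that for every ε ∈ (0,1/4), some ρ₀(ε) > 0, all 0 < ρ < ρ₀, all large
N, some δ > 0 and every δ-near-minimiser Ψ (Dirichlet, L = (N/ρ)^{1/3}), the expected number of
particles in the shell Λ_L ∖ Λ'_ε (Λ'_ε = (εL, L−εL)³), N_shell = Σ_i ∫ 1[x_i ∉ Λ'_ε] |Ψ|² =
tr(1_shell γ_Ψ), is ≤ C·ε·N (shell volume fraction is 1−(1−2ε)³ ≤ 6ε; heuristically N_shell/N →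
volume fraction since the density is flat beyond the healing length; C = 12 expected to work). Proof
technology: localised leading-order energy lower bound à la Lieb–Yngvason 1998 / LSSY2005 Thm 2.4
(cell method) applied to shell and bulk separately, E ≳ 4πa(N_shell²/|shell| + N_bulk²/|bulk|),
against the upper bound E₀ ≤ 4πaρN(1 + O(√(ρa³))): convexity forces N_shell/N ≤ vol. fraction +
o_ρ(1). Known-technique, not in print in this form; moderate depth, heavy in Lean. -/
@[route_item "route-AtomisticToContinuum-BECInfraredBound", crux]
def BecShellMass : Prop :=
  ∀ v : ℝ → ENNReal, Literature.MathematicalPhysics.QuantumManyBody.BoseGas.IsRepulsiveFiniteRange v → ∃ C : ℝ, 0 < C ∧ ∀ ε : ℝ, 0 < ε → ε < 1 / 4 → ∃ ρ₀ : ℝ, 0 < ρ₀ ∧ ∀ ρ : ℝ, 0 < ρ → ρ < ρ₀ → ∀ᶠ N : ℕ in Filter.atTop, ∃ δ : ENNReal, 0 < δ ∧ ∀ Ψ : Literature.MathematicalPhysics.QuantumManyBody.BoseGas.TrialState N (Literature.MathematicalPhysics.QuantumManyBody.BoseGas.sideLength ρ N), Literature.MathematicalPhysics.QuantumManyBody.BoseGas.energy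 v Ψ ≤ Literature.MathematicalPhysics.QuantumManyBody.BoseGas.groundStateEnergy v N (Literature.MathematicalPhysics.QuantumManyBody.BoseGas.sideLength ρ N) + δ → ∑ i : Fin N, ∫⁻ X, {x : EuclideanSpace ℝ (Fin 3) | ∀ j, x j ∈ Set.Ioo (ε * Literature.MathematicalPhysics.QuantumManyBody.BoseGas.sideLength ρ N) (Literature.MathematicalPhysics.QuantumManyBody.BoseGas.sideLength ρ N - ε * Literature.MathematicalPhysics.QuantumManyBody.BoseGas.sideLength ρ N)}ᶜ.indicator (fun _ => (1 : ENNReal)) (X i) * (‖Ψ.ψ X‖₊ : ENNReal) ^ 2 ≤ ENNReal.ofReal (C * ε * N)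

/-- item stmt-AtomisticToContinuum-8912 · crux · rank 9 · closed · proved by Summit.AtomisticToContinuum.BoseEinsteinCondensation.Theorems.BecFreeGas_proof @ 264277954012 (prover) · by planner
why it might fail: v a.e. 0 on (0,∞) may have v(0) = ⊤ or v ≠ 0 on a null set: needs energy v = energy 0 (pair-distance preimages of null sets are null in (ℝ³)^N), then the free Dirichlet gas in X_B1 form (mode φ₀, gap 3π²/L², share (8/π²)³); in tree only HasGroundStateBEC 0 ρ (sub-cell modes): true, M-size, unproved.
sources: LSSY2005, Literature.MathematicalPhysics.QuantumManyBody.BoseGas.hasGroundStateBEC_zero, Literature.Barriers.AtomisticToContinuum.KineticGapLengthScales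
[support] FREE-GAS CASE (new; refuters g12-5/g28-0 knock-on): for every repulsive finite-range v
that IS a.e. zero on (0,∞) the interaction term vanishes a.e. on configuration space (pair-distance
level sets of a null set are null), so energy = kinetic: the free Dirichlet gas. Then X_B1 for v: E₀
= 3Nπ²/L² (sharp Poincaré on (0,L)), gap 3π²/L² to the first excited level, so a δ-near-minimiser
with δ ≤ η²·3π²/L² is L²-within η of e^(iα)χ^⊗N, χ = ∏_j (2/L)^(1/2) sin(πx_j/L);
√occupation(φ₀,·)/√N is 1-Lipschitz in L², and occupation(φ₀, χ^⊗N) = N·|⟨L^(-3/2), χ⟩|² = (8/π²)³N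
≈ 0.533N, whence ⟨φ₀,γ_Ψφ₀⟩ ≥ N/4 for η small: c = 1/4, any ρ₀. Provable now; Lean-heavy (1-D
Wirtinger/Poincaré with sharp constant, tensorisation, explicit sine integrals). [difficulty: M]
[sources: LSSY2005] -/
@[route_item "route-AtomisticToContinuum-BECInfraredBound", crux]
def BecFreeGas : Prop :=
  ∀ v : ℝ → ENNReal, Literature.MathematicalPhysics.QuantumManyBody.BoseGas.IsRepulsiveFiniteRange v → (∀ᵐ r ∂(MeasureTheory.volume.restrict (Set.Ioi (0 : ℝ))), v r = 0) → ∃ ρ₀ : ℝ, 0 < ρ₀ ∧ ∀ ρ : ℝ, 0 < ρ → ρ < ρ₀ → ∃ c : ℝ, 0 < c ∧ ∀ᶠ N : ℕ in Filter.atTop, ∃ δ : ENNReal, 0 < δ ∧ ∀ Ψ : Literature.MathematicalPhysics.QuantumManyBody.BoseGas.TrialState N (Literature.MathematicalPhysics.QuantumManyBody.BoseGas.sideLength ρ N), Literature.MathematicalPhysics.QuantumManyBody.BoseGas.energy v Ψ ≤ Literature.MathematicalPhysics.QuantumManyBody.BoseGas.groundStateEnergy v N (Literature.MathematicalPhysics.QuantumManyBody.BoseGas.sideLength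 ρ N) + δ → ENNReal.ofReal (c * N) ≤ Literature.MathematicalPhysics.QuantumManyBody.BoseGas.occupation N ((Literature.MathematicalPhysics.QuantumManyBody.BoseGas.box (Literature.MathematicalPhysics.QuantumManyBody.BoseGas.sideLength ρ N)).indicator fun _ => ((Real.sqrt (Literature.MathematicalPhysics.QuantumManyBody.BoseGas.sideLength ρ N ^ 3))⁻¹ : ℂ)) Ψ.ψ

/-- item stmt-AtomisticToContinuum-9015 · crux · rank 9 · closed · proved by Summit.AtomisticToContinuum.BoseEinsteinCondensation.Theorems.becWindowCount_proof @ 6365d280a3dd (prover) · by planner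
why it might fail: Routine but unproved hypothesis of `closes`: finite lattice count with the SUP norm at non-integer R = K√ρL ((2⌊R⌋+1)³ points, Σ1/‖k‖∞ ≤ 13R(R+1)) and the boundary term 13Kρ^(1/3)N^(2/3) absorbed only eventually in N; risk is formal (ENNReal tsum over a finite subtype, ofReal of products).
sources: LSSY2005, DysonLiebSimon1978, refuter notes g41-27/g41-12 on stmt-AtomisticToContinuum-8911 (arithmetic verified)
[support] WINDOW COUNT (glue piece 1/3 of the pointwise-in-v mode counting that replaces stmt-0735):
for every repulsive finite-range v, the window IR bound for v (body of BecIrWindow after its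
non-triviality hypothesis) implies that the infrared window carries an arbitrarily small particle
fraction: ∀ ε ∈ (0,1/4) ∀ K > 0 ∀ η > 0 ∃ ρ₀ ∀ ρ < ρ₀ ∀ᶠ N ∃ δ ∀ δ-near-minimisers Ψ: Σ_{k≠0,
‖k‖≤K√ρL} ⟨φ'_k,γ_Ψφ'_k⟩ ≤ ηN (tsum over the subtype). Proof: lattice-point count #{‖k‖∞ ≤ R} =
(2⌊R⌋+1)³ and Σ_{0<‖k‖∞≤R} 1/‖k‖∞ ≤ 13R(R+1), R = K√ρL, give window sum ≤ C(cK³√ρ·N + 13K²√ρ·N +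
13Kρ^(1/3)N^(2/3) + c); choose ρ₀ with C·c(K)√ρ₀ ≤ η/2, then N large; same δ. Arithmetic over a
finite subtype; provable now. [sources: LSSY2005] -/
@[route_item "route-AtomisticToContinuum-BECInfraredBound", crux]
def BecWindowCount : Prop :=
  ∀ v : ℝ → ENNReal, Literature.MathematicalPhysics.QuantumManyBody.BoseGas.IsRepulsiveFiniteRange v → (∀ ε : ℝ, 0 < ε → ε < 1 / 4 → ∀ K : ℝ, 0 < K → ∃ ρ₀ : ℝ, 0 < ρ₀ ∧ ∃ C : ℝ, 0 < C ∧ ∀ ρ : ℝ, 0 < ρ → ρ < ρ₀ → ∀ᶠ N : ℕ in Filter.atTop, ∃ δ : ENNReal, 0 < δ ∧ ∀ Ψ : Literature.MathematicalPhysics.QuantumManyBody.BoseGas.TrialState N (Literature.MathematicalPhysics.QuantumManyBody.BoseGas.sideLength ρ N), Literature.MathematicalPhysics.QuantumManyBody.BoseGas.energy v Ψ ≤ Literature.MathematicalPhysics.QuantumManyBody.BoseGas.groundStateEnergy v N (Literature.MathematicalPhysics.QuantumManyBody.BoseGas.sideLength ρ N) + δ → ∀ k : Fin 3 → ℤ,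 k ≠ 0 → ‖(fun j => (k j : ℝ))‖ ≤ K * Real.sqrt ρ * Literature.MathematicalPhysics.QuantumManyBody.BoseGas.sideLength ρ N → Literature.MathematicalPhysics.QuantumManyBody.BoseGas.occupation N ({x : EuclideanSpace ℝ (Fin 3) | ∀ j, x j ∈ Set.Ioo (ε * Literature.MathematicalPhysics.QuantumManyBody.BoseGas.sideLength ρ N) (Literature.MathematicalPhysics.QuantumManyBody.BoseGas.sideLength ρ N - ε * Literature.MathematicalPhysics.QuantumManyBody.BoseGas.sideLength ρ N)}.indicator fun x => ((Real.sqrt (((1 - 2 * ε) * Literature.MathematicalPhysics.QuantumManyBody.BoseGas.sideLength ρ N) ^ 3))⁻¹ : ℂ) * Complex.exp (Complex.I * ↑(2 * Real.pi / ((1 - 2 * ε) * Literature.MathematicalPhysics.QuantumManyBody.BoseGas.sideLength ρ N) * ∑ j, (k j : ℝ) * x j))) Ψ.ψ ≤ ENNReal.ofReal (C * (1 + Real.sqrt ρ * Literature.MathematicalPhysics.QuantumManyBody.BoseGas.sideLength ρ N / ‖(fun j => (k j : ℝ))‖))) → ∀ ε : ℝ, 0 < ε → ε < 1 / 4 → ∀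 K : ℝ, 0 < K → ∀ η : ℝ, 0 < η → ∃ ρ₀ : ℝ, 0 < ρ₀ ∧ ∀ ρ : ℝ, 0 < ρ → ρ < ρ₀ → ∀ᶠ N : ℕ in Filter.atTop, ∃ δ : ENNReal, 0 < δ ∧ ∀ Ψ : Literature.MathematicalPhysics.QuantumManyBody.BoseGas.TrialState N (Literature.MathematicalPhysics.QuantumManyBody.BoseGas.sideLength ρ N), Literature.MathematicalPhysics.QuantumManyBody.BoseGas.energy v Ψ ≤ Literature.MathematicalPhysics.QuantumManyBody.BoseGas.groundStateEnergy v N (Literature.MathematicalPhysics.QuantumManyBody.BoseGas.sideLength ρ N) + δ → ∑' k : {k : Fin 3 → ℤ // k ≠ 0 ∧ ‖(fun j => (k j : ℝ))‖ ≤ K * Real.sqrt ρ * Literature.MathematicalPhysics.QuantumManyBody.BoseGas.sideLength ρ N}, Literature.MathematicalPhysics.QuantumManyBody.BoseGas.occupation N ({x : EuclideanSpace ℝ (Fin 3) | ∀ j, x j ∈ Set.Ioo (ε * Literature.MathematicalPhysics.QuantumManyBody.BoseGas.sideLength ρ N) (Literature.MathematicalPhysics.QuantumManyBody.BoseGas.sideLength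 ρ N - ε * Literature.MathematicalPhysics.QuantumManyBody.BoseGas.sideLength ρ N)}.indicator fun x => ((Real.sqrt (((1 - 2 * ε) * Literature.MathematicalPhysics.QuantumManyBody.BoseGas.sideLength ρ N) ^ 3))⁻¹ : ℂ) * Complex.exp (Complex.I * ↑(2 * Real.pi / ((1 - 2 * ε) * Literature.MathematicalPhysics.QuantumManyBody.BoseGas.sideLength ρ N) * ∑ j, (k.1 j : ℝ) * x j))) Ψ.ψ ≤ ENNReal.ofReal (η * N)

/-- item stmt-AtomisticToContinuum-9026 · crux · rank 9 · closed · proved by Summit.AtomisticToContinuum.BoseEinsteinCondensation.Theorems.BecDepletionSplit_proof @ e8823c467b0f (prover) · by planner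
why it might fail: Routine but unproved hypothesis of `closes`: ENNReal tsum algebra — tsum over {k ≠ 0} = window ⊔ tail subtypes (Summable automatic in ℝ≥0∞), θ′ = max(1/2,(1+θ)/2), η = (1−θ)/2, corner θ ≤ 0 where ofReal(θN) = 0 forces the tail to vanish; intersecting two ∀ᶠ/∃δ clauses; formal risk only.
sources: LSSY2005, Mathlib ENNReal.tsum_add / tsum_union_disjoint, refuter notes g41-12 on stmt-AtomisticToContinuum-8911
[support] DEPLETION SPLIT (glue piece 2/3): for every repulsive finite-range v, (window count for v:
conclusion body of BecWindowCount) → (UV tail for v: body of BecUvTail) → inner-box depletion for v: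
∃ θ' < 1 ∀ ε ∈ (0,1/4) ∃ ρ₀ ∀ ρ < ρ₀ ∀ᶠ N ∃ δ ∀ δ-near-minimisers Ψ: Σ'_{k≠0} ⟨φ'_k,γ_Ψφ'_k⟩ ≤ θ'N.
Proof: take K, θ from the tail hypothesis, θ' = (1+θ)/2 (∨ 1/2), η = (1−θ)/2 in the window count;
split the ENNReal tsum over {k ≠ 0} into {‖k‖ ≤ K√ρL} and {‖k‖ > K√ρL} (tsum over a disjoint union
of subtypes = sum of the two tsums); ρ₀ = min, intersect the eventualities, δ = min. Pure tsum
algebra; provable now. [sources: LSSY2005] -/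
@[route_item "route-AtomisticToContinuum-BECInfraredBound", crux]
def BecDepletionSplit : Prop :=
  ∀ v : ℝ → ENNReal, Literature.MathematicalPhysics.QuantumManyBody.BoseGas.IsRepulsiveFiniteRange v → (∀ ε : ℝ, 0 < ε → ε < 1 / 4 → ∀ K : ℝ, 0 < K → ∀ η : ℝ, 0 < η → ∃ ρ₀ : ℝ, 0 < ρ₀ ∧ ∀ ρ : ℝ, 0 < ρ → ρ < ρ₀ → ∀ᶠ N : ℕ in Filter.atTop, ∃ δ : ENNReal, 0 < δ ∧ ∀ Ψ : Literature.MathematicalPhysics.QuantumManyBody.BoseGas.TrialState N (Literature.MathematicalPhysics.QuantumManyBody.BoseGas.sideLength ρ N), Literature.MathematicalPhysics.QuantumManyBody.BoseGas.energy v Ψ ≤ Literature.MathematicalPhysics.QuantumManyBody.BoseGas.groundStateEnergy v N (Literature.MathematicalPhysics.QuantumManyBody.BoseGas.sideLength ρ N) + δ → ∑' k : {k : Fin 3 → ℤ // k ≠ 0 ∧ ‖(fun j => (k j : ℝ))‖ ≤ K * Real.sqrt ρ * Literature.MathematicalPhysics.QuantumManyBody.BoseGas.sideLength ρ N}, Literature.MathematicalPhysics.QuantumManyBody.BoseGas.occupation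 N ({x : EuclideanSpace ℝ (Fin 3) | ∀ j, x j ∈ Set.Ioo (ε * Literature.MathematicalPhysics.QuantumManyBody.BoseGas.sideLength ρ N) (Literature.MathematicalPhysics.QuantumManyBody.BoseGas.sideLength ρ N - ε * Literature.MathematicalPhysics.QuantumManyBody.BoseGas.sideLength ρ N)}.indicator fun x => ((Real.sqrt (((1 - 2 * ε) * Literature.MathematicalPhysics.QuantumManyBody.BoseGas.sideLength ρ N) ^ 3))⁻¹ : ℂ) * Complex.exp (Complex.I * ↑(2 * Real.pi / ((1 - 2 * ε) * Literature.MathematicalPhysics.QuantumManyBody.BoseGas.sideLength ρ N) * ∑ j, (k.1 j : ℝ) * x j))) Ψ.ψ ≤ ENNReal.ofReal (η * N)) → (∃ K : ℝ, 0 < K ∧ ∃ θ : ℝ, θ < 1 ∧ ∀ ε : ℝ, 0 < ε → ε < 1 / 4 → ∃ ρ₀ : ℝ, 0 < ρ₀ ∧ ∀ ρ : ℝ, 0 < ρ → ρ < ρ₀ → ∀ᶠ N : ℕ in Filter.atTop, ∃ δ : ENNReal, 0 < δ ∧ ∀ Ψ : Literature.MathematicalPhysics.QuantumManyBody.BoseGas.TrialState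 N (Literature.MathematicalPhysics.QuantumManyBody.BoseGas.sideLength ρ N), Literature.MathematicalPhysics.QuantumManyBody.BoseGas.energy v Ψ ≤ Literature.MathematicalPhysics.QuantumManyBody.BoseGas.groundStateEnergy v N (Literature.MathematicalPhysics.QuantumManyBody.BoseGas.sideLength ρ N) + δ → ∑' k : {k : Fin 3 → ℤ // K * Real.sqrt ρ * Literature.MathematicalPhysics.QuantumManyBody.BoseGas.sideLength ρ N < ‖(fun j => (k j : ℝ))‖}, Literature.MathematicalPhysics.QuantumManyBody.BoseGas.occupation N ({x : EuclideanSpace ℝ (Fin 3) | ∀ j, x j ∈ Set.Ioo (ε * Literature.MathematicalPhysics.QuantumManyBody.BoseGas.sideLength ρ N) (Literature.MathematicalPhysics.QuantumManyBody.BoseGas.sideLength ρ N - ε * Literature.MathematicalPhysics.QuantumManyBody.BoseGas.sideLength ρ N)}.indicator fun x => ((Real.sqrt (((1 - 2 * ε) * Literature.MathematicalPhysics.QuantumManyBody.BoseGas.sideLength ρ N) ^ 3))⁻¹ : ℂ) * Complex.exp (Complex.I * ↑(2 * Real.pi / ((1 - 2 * ε) * Literature.MathematicalPhysics.QuantumManyBody.BoseGas.sideLength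 ρ N) * ∑ j, ((k : Fin 3 → ℤ) j : ℝ) * x j))) Ψ.ψ ≤ ENNReal.ofReal (θ * N)) → ∃ θ : ℝ, θ < 1 ∧ ∀ ε : ℝ, 0 < ε → ε < 1 / 4 → ∃ ρ₀ : ℝ, 0 < ρ₀ ∧ ∀ ρ : ℝ, 0 < ρ → ρ < ρ₀ → ∀ᶠ N : ℕ in Filter.atTop, ∃ δ : ENNReal, 0 < δ ∧ ∀ Ψ : Literature.MathematicalPhysics.QuantumManyBody.BoseGas.TrialState N (Literature.MathematicalPhysics.QuantumManyBody.BoseGas.sideLength ρ N), Literature.MathematicalPhysics.QuantumManyBody.BoseGas.energy v Ψ ≤ Literature.MathematicalPhysics.QuantumManyBody.BoseGas.groundStateEnergy v N (Literature.MathematicalPhysics.QuantumManyBody.BoseGas.sideLength ρ N) + δ → ∑' k : {k : Fin 3 → ℤ // k ≠ 0}, Literature.MathematicalPhysics.QuantumManyBody.BoseGas.occupation N ({x : EuclideanSpace ℝ (Fin 3) | ∀ j, x j ∈ Set.Ioo (ε * Literature.MathematicalPhysics.QuantumManyBody.BoseGas.sideLength ρ N) (Literature.MathematicalPhysics.QuantumManyBody.BoseGas.sideLength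 ρ N - ε * Literature.MathematicalPhysics.QuantumManyBody.BoseGas.sideLength ρ N)}.indicator fun x => ((Real.sqrt (((1 - 2 * ε) * Literature.MathematicalPhysics.QuantumManyBody.BoseGas.sideLength ρ N) ^ 3))⁻¹ : ℂ) * Complex.exp (Complex.I * ↑(2 * Real.pi / ((1 - 2 * ε) * Literature.MathematicalPhysics.QuantumManyBody.BoseGas.sideLength ρ N) * ∑ j, (k.1 j : ℝ) * x j))) Ψ.ψ ≤ ENNReal.ofReal (θ * N)

/-- item stmt-AtomisticToContinuum-9034 · crux · rank 9 · closed · proved by Summit.AtomisticToContinuum.BoseEinsteinCondensation.Theorems.BecDepletionCounting_proof @ dcd7be299943 (prover) · by planner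
why it might fail: Parseval Σ_{k∈ℤ³}⟨φ′_k,γφ′_k⟩ = N − N_shell for `occupation` on the translated inner cube (3-D Fourier ONB after affine transport; torus analogue in tree) + seminorm step φ₀ = (1−2ε)^{3/2}φ′_0 + w, ⟨w,γw⟩ ≤ 6ε·N_shell: true (DLS sum rule), Lean-heavy; fails only formally (tsum–lintegral swap, N=0).
sources: LSSY2005, DysonLiebSimon1978, Literature.MathematicalPhysics.QuantumManyBody.BoseGas.tsum_sq_cellFourierCoeff, Summit.AtomisticToContinuum.BoseEinsteinCondensation.Theorems.IRModeCounting_proof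
[support] DEPLETION COUNTING (glue piece 3/3 — the Parseval/sum-rule step of DLS–KLS mode counting,
continuum inner-box form): for every repulsive finite-range v, (inner-box depletion for v:
conclusion body of BecDepletionSplit) → (shell mass for v: body of BecShellMass) → X_B1 for v (body
of BecZeroModeThesis). Proof: (1) Parseval on Λ' for the ONB (φ'_k)_{k∈ℤ³} of L²(Λ') applied to x ↦
Ψ(x,Y), Bose symmetry: Σ_{k∈ℤ³}⟨φ'_k,γ_Ψφ'_k⟩ = N − N_shell, so ⟨φ'_0,γφ'_0⟩ ≥ N(1 − C_sh·ε − θ');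
fix ε ≤ (1−θ')/(2C_sh) ∧ 1/8 (θ' is ε-independent, C_sh too); (2) φ₀ = (1−2ε)^(3/2)φ'_0 + w with w =
L^(-3/2)·1_{Λ∖Λ'}: √occupation is a seminorm in the mode and ⟨w,γw⟩ ≤ ‖w‖²·N_shell ≤ 6ε·C_sh·ε·N,
whence ⟨φ₀,γ_Ψφ₀⟩ ≥ (1−θ')N/8 =: cN for ε small; δ = min(δ_depl, δ_shell). TRUE; Lean-heavy: 3-D
Fourier/Parseval on a cube for `occupation` (Mathlib mFourierBasis / hasSum_sq_mFourierCoeff on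
UnitAddTorus (Fin 3) after affine transport), tsum–lintegral interchange, ENNReal bookkeeping.
[sources: LSSY2005 Ch. 11 (11.26)–(11.27), DysonLiebSimon1978] -/
@[route_item "route-AtomisticToContinuum-BECInfraredBound", crux]
def BecDepletionCounting : Prop :=
  ∀ v : ℝ → ENNReal, Literature.MathematicalPhysics.QuantumManyBody.BoseGas.IsRepulsiveFiniteRange v → (∃ θ : ℝ, θ < 1 ∧ ∀ ε : ℝ, 0 < ε → ε < 1 / 4 → ∃ ρ₀ : ℝ, 0 < ρ₀ ∧ ∀ ρ : ℝ, 0 < ρ → ρ < ρ₀ → ∀ᶠ N : ℕ in Filter.atTop, ∃ δ : ENNReal, 0 < δ ∧ ∀ Ψ : Literature.MathematicalPhysics.QuantumManyBody.BoseGas.TrialState N (Literature.MathematicalPhysics.QuantumManyBody.BoseGas.sideLength ρ N), Literature.MathematicalPhysics.QuantumManyBody.BoseGas.energy v Ψ ≤ Literature.MathematicalPhysics.QuantumManyBody.BoseGas.groundStateEnergy v N (Literature.MathematicalPhysics.QuantumManyBody.BoseGas.sideLength ρ N) + δ → ∑' k : {k : Fin 3 → ℤ // k ≠ 0}, Literature.MathematicalPhysics.QuantumManyBody.BoseGas.occupation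 N ({x : EuclideanSpace ℝ (Fin 3) | ∀ j, x j ∈ Set.Ioo (ε * Literature.MathematicalPhysics.QuantumManyBody.BoseGas.sideLength ρ N) (Literature.MathematicalPhysics.QuantumManyBody.BoseGas.sideLength ρ N - ε * Literature.MathematicalPhysics.QuantumManyBody.BoseGas.sideLength ρ N)}.indicator fun x => ((Real.sqrt (((1 - 2 * ε) * Literature.MathematicalPhysics.QuantumManyBody.BoseGas.sideLength ρ N) ^ 3))⁻¹ : ℂ) * Complex.exp (Complex.I * ↑(2 * Real.pi / ((1 - 2 * ε) * Literature.MathematicalPhysics.QuantumManyBody.BoseGas.sideLength ρ N) * ∑ j, (k.1 j : ℝ) * x j))) Ψ.ψ ≤ ENNReal.ofReal (θ * N)) → (∃ C : ℝ, 0 < C ∧ ∀ ε : ℝ, 0 < ε → ε < 1 / 4 → ∃ ρ₀ : ℝ, 0 < ρ₀ ∧ ∀ ρ : ℝ, 0 < ρ → ρ < ρ₀ → ∀ᶠ N : ℕ in Filter.atTop, ∃ δ : ENNReal, 0 < δ ∧ ∀ Ψ : Literature.MathematicalPhysics.QuantumManyBody.BoseGas.TrialState N (Literature.MathematicalPhysics.QuantumManyBody.BoseGas.sideLength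 ρ N), Literature.MathematicalPhysics.QuantumManyBody.BoseGas.energy v Ψ ≤ Literature.MathematicalPhysics.QuantumManyBody.BoseGas.groundStateEnergy v N (Literature.MathematicalPhysics.QuantumManyBody.BoseGas.sideLength ρ N) + δ → ∑ i : Fin N, ∫⁻ X, {x : EuclideanSpace ℝ (Fin 3) | ∀ j, x j ∈ Set.Ioo (ε * Literature.MathematicalPhysics.QuantumManyBody.BoseGas.sideLength ρ N) (Literature.MathematicalPhysics.QuantumManyBody.BoseGas.sideLength ρ N - ε * Literature.MathematicalPhysics.QuantumManyBody.BoseGas.sideLength ρ N)}ᶜ.indicator (fun _ => (1 : ENNReal)) (X i) * (‖Ψ.ψ X‖₊ : ENNReal) ^ 2 ≤ ENNReal.ofReal (C * ε * N)) → ∃ ρ₀ : ℝ, 0 < ρ₀ ∧ ∀ ρ : ℝ, 0 < ρ → ρ < ρ₀ → ∃ c : ℝ, 0 < c ∧ ∀ᶠ N : ℕ in Filter.atTop, ∃ δ : ENNReal, 0 < δ ∧ ∀ Ψ : Literature.MathematicalPhysics.QuantumManyBody.BoseGas.TrialState N (Literature.MathematicalPhysics.QuantumManyBody.BoseGas.sideLength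 ρ N), Literature.MathematicalPhysics.QuantumManyBody.BoseGas.energy v Ψ ≤ Literature.MathematicalPhysics.QuantumManyBody.BoseGas.groundStateEnergy v N (Literature.MathematicalPhysics.QuantumManyBody.BoseGas.sideLength ρ N) + δ → ENNReal.ofReal (c * N) ≤ Literature.MathematicalPhysics.QuantumManyBody.BoseGas.occupation N ((Literature.MathematicalPhysics.QuantumManyBody.BoseGas.box (Literature.MathematicalPhysics.QuantumManyBody.BoseGas.sideLength ρ N)).indicator fun _ => ((Real.sqrt (Literature.MathematicalPhysics.QuantumManyBody.BoseGas.sideLength ρ N ^ 3))⁻¹ : ℂ)) Ψ.ψ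

/-- item stmt-AtomisticToContinuum-0689 · support · rank 2 · open · by planner
why it might fail: SUPERSEDED — do not claim: full-box plane waves see the Dirichlet wall layer (axis modes carry ≳ 0.15·L/a particles, refuters g2-4/g4-7), so no ρ-uniform C exists; replaced by BecIrWindow (8911) + BecUvTail (8823). Not a hypothesis of `closes`.
sources: LSSY2005, DysonLiebSimon1978, refuter notes g2-4/g4-7 on stmt-AtomisticToContinuum-0689
T = 0 INFRARED BOUND (crux): for every repulsive finite-range v there are ρ₀ > 0 and C (independent
of ρ) such that for 0 < ρ < ρ₀, all large N, some δ > 0 and every δ-near-minimiser Ψ (Dirichlet, box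
side L = (N/ρ)^{1/3}), the occupation of each plane wave φ_k = L^{-3/2} e^{2πi k·x/L} 1_box, k ∈
ℤ³∖{0}, satisfies n_Ψ(k) ≤ C(√ρ·L/|k| + ρ²L⁴/|k|⁴) — the Bogoliubov shape √(ρa)/|p| + (ρa)²/|p|⁴ at
p = 2πk/L with a absorbed into C. Continuum zero-temperature analogue of Gaussian domination (DLS
1978 / KLS 1988); open. -/
@[route_item "route-AtomisticToContinuum-BECInfraredBound"]
def BecInfraredBound : Prop :=
  ∀ v : ℝ → ℝ≥0∞, Literature.MathematicalPhysics.QuantumManyBody.BoseGas.IsRepulsiveFiniteRange v → ∃ ρ₀ : ℝ, 0 < ρ₀ ∧ ∃ C : ℝ, 0 < C ∧ ∀ ρ : ℝ, 0 < ρ → ρ < ρ₀ → ∀ᶠ N : ℕ in Filter.atTop, ∃ δ : ℝ≥0∞, 0 < δ ∧ ∀ Ψ : Literature.MathematicalPhysics.QuantumManyBody.BoseGas.TrialState N (Literature.MathematicalPhysics.QuantumManyBody.BoseGas.sideLength ρ N), Literature.MathematicalPhysics.QuantumManyBody.BoseGas.energy v Ψ ≤ Literature.MathematicalPhysics.QuantumManyBody.BoseGas.groundStateEnergy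 v N (Literature.MathematicalPhysics.QuantumManyBody.BoseGas.sideLength ρ N) + δ → ∀ k : Fin 3 → ℤ, k ≠ 0 → Literature.MathematicalPhysics.QuantumManyBody.BoseGas.occupation N ((Literature.MathematicalPhysics.QuantumManyBody.BoseGas.box (Literature.MathematicalPhysics.QuantumManyBody.BoseGas.sideLength ρ N)).indicator fun x => ((Real.sqrt (Literature.MathematicalPhysics.QuantumManyBody.BoseGas.sideLength ρ N ^ 3))⁻¹ : ℂ) * Complex.exp (Complex.I * (2 * Real.pi / Literature.MathematicalPhysics.QuantumManyBody.BoseGas.sideLength ρ N * ∑ j, (k j : ℝ) * x j : ℝ))) Ψ.ψ ≤ ENNReal.ofReal (C * (Real.sqrt ρ * Literature.MathematicalPhysics.QuantumManyBody.BoseGas.sideLength ρ N / ‖(fun j => (k j : ℝ))‖ + ρ ^ 2 * Literature.MathematicalPhysics.QuantumManyBody.BoseGas.sideLength ρ N ^ 4 / ‖(fun j => (k j : ℝ))‖ ^ 4))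

/-- item stmt-AtomisticToContinuum-0733 · support · rank 2 · open · by planner
why it might fail: AS TYPED IT IS FALSE (refuters g12-5/g15-5/g24-0/g26-1/g28-0): v ≡ 0 is admitted (free Dirichlet gas puts 0.044N in inner mode e₁) and the sharp-window ‖k‖⁻⁴ branch fails by boundary flux. Do not prove. Replaced by BecIrWindow (8911). Not a hypothesis of `closes`.
sources: DysonLiebSimon1978, KLS1988PRL, LSSY2005, GavoretNozieres1964, refuter notes g12-5/g15-5/g24-0 on stmt-AtomisticToContinuum-0733
T = 0 INFRARED BOUND, INNER-BOX FORM (supersedes stmt-AtomisticToContinuum-0689 per refuter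
g2-4/g4-7: min not sum; Dirichlet walls defeat full-box plane waves). For every repulsive
finite-range v and every ε ∈ (0,1/4) there are ρ₀ > 0 and C (C independent of ρ) such that for 0 < ρ
< ρ₀, all large N, some δ > 0 and every δ-near-minimiser Ψ (Dirichlet, box side L = (N/ρ)^{1/3}):
with the INNER box Λ' = (εL, L−εL)³ of side L' = (1−2ε)L and its plane-wave ONB φ'_k = L'^{-3/2}
e^{2πi k·x/L'} 1_{Λ'} (k ∈ ℤ³), every k ≠ 0 has occupation ⟨φ'_k, γ_Ψ φ'_k⟩ ≤ C·min(√ρ·L/|k|,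
ρ²L⁴/|k|⁴) (Bogoliubov shape √(ρa)/|p| ∧ (ρa)²/|p|⁴ at p = 2πk/L'; |k| = sup norm, immaterial). Why
inner box: the Dirichlet condensate profile is flat on Λ' up to e^{−εL/ξ} (ξ = healing length,
independent of L) and inner plane waves with k ≠ 0 are exactly orthogonal to 1_{Λ'}, so the wall
boundary layer (which gives n_k ≳ 0.15 L/a for full-box axis modes, g2-4) does not leak; min form is
the expected truth. Continuum T = 0 analogue of Gaussian domination (DysonLiebSimon1978,
KennedyLiebShastry1988); OPEN — the route's crux. -/
@[route_item "route-AtomisticToContinuum-BECInfraredBound"]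
def BecIrBoundInner : Prop :=
  ∀ v : ℝ → ENNReal, Literature.MathematicalPhysics.QuantumManyBody.BoseGas.IsRepulsiveFiniteRange v → ∀ ε : ℝ, 0 < ε → ε < 1 / 4 → ∃ ρ₀ : ℝ, 0 < ρ₀ ∧ ∃ C : ℝ, 0 < C ∧ ∀ ρ : ℝ, 0 < ρ → ρ < ρ₀ → ∀ᶠ N : ℕ in Filter.atTop, ∃ δ : ENNReal, 0 < δ ∧ ∀ Ψ : Literature.MathematicalPhysics.QuantumManyBody.BoseGas.TrialState N (Literature.MathematicalPhysics.QuantumManyBody.BoseGas.sideLength ρ N), Literature.MathematicalPhysics.QuantumManyBody.BoseGas.energy v Ψ ≤ Literature.MathematicalPhysics.QuantumManyBody.BoseGas.groundStateEnergy v N (Literature.MathematicalPhysics.QuantumManyBody.BoseGas.sideLength ρ N) + δ → ∀ k : Fin 3 → ℤ, k ≠ 0 → Literature.MathematicalPhysics.QuantumManyBody.BoseGas.occupation N ({x : EuclideanSpace ℝ (Fin 3) | ∀ j, x j ∈ Set.Ioo (ε * Literature.MathematicalPhysics.QuantumManyBody.BoseGas.sideLength ρ N) (Literature.MathematicalPhysics.QuantumManyBody.BoseGas.sideLength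 ρ N - ε * Literature.MathematicalPhysics.QuantumManyBody.BoseGas.sideLength ρ N)}.indicator fun x => ((Real.sqrt (((1 - 2 * ε) * Literature.MathematicalPhysics.QuantumManyBody.BoseGas.sideLength ρ N) ^ 3))⁻¹ : ℂ) * Complex.exp (Complex.I * ↑(2 * Real.pi / ((1 - 2 * ε) * Literature.MathematicalPhysics.QuantumManyBody.BoseGas.sideLength ρ N) * ∑ j, (k j : ℝ) * x j))) Ψ.ψ ≤ ENNReal.ofReal (C * min (Real.sqrt ρ * Literature.MathematicalPhysics.QuantumManyBody.BoseGas.sideLength ρ N / ‖(fun j => (k j : ℝ))‖) (ρ ^ 2 * Literature.MathematicalPhysics.QuantumManyBody.BoseGas.sideLength ρ N ^ 4 / ‖(fun j => (k j : ℝ))‖ ^ 4))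

/-- item stmt-AtomisticToContinuum-0690 · support · rank 3 · open · by planner
why it might fail: SUPERSEDED — do not claim: its hypothesis is BecInfraredBound (0689) verbatim, believed false as typed, so the implication is idle; the live counting chain is BecWindowCount → BecDepletionSplit → BecDepletionCounting. Not a hypothesis of `closes`.
sources: LSSY2005, DysonLiebSimon1978
Mode counting: the infrared bound implies X_B1. Ingredients: (1) Parseval — for a Dirichlet trial
state, Σ_{k∈ℤ³} occupation N φ_k Ψ.ψ = N since (φ_k) is an ONB of L²(box); (2) lattice-sum estimate
Σ_{k≠0} min(√ρ L/|k|, ρ²L⁴/|k|⁴) ≤ C₁ ρ^{3/2} L³ = C₁ N √ρ (split at |k| ≈ L√ρ); (3) choose ρ₀ with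
C·C₁√ρ₀ ≤ 1/2, c = 1/2. -/
@[route_item "route-AtomisticToContinuum-BECInfraredBound"]
def BecIrImpliesZeroMode : Prop :=
  (∀ v : ℝ → ℝ≥0∞, Literature.MathematicalPhysics.QuantumManyBody.BoseGas.IsRepulsiveFiniteRange v → ∃ ρ₀ : ℝ, 0 < ρ₀ ∧ ∃ C : ℝ, 0 < C ∧ ∀ ρ : ℝ, 0 < ρ → ρ < ρ₀ → ∀ᶠ N : ℕ in Filter.atTop, ∃ δ : ℝ≥0∞, 0 < δ ∧ ∀ Ψ : Literature.MathematicalPhysics.QuantumManyBody.BoseGas.TrialState N (Literature.MathematicalPhysics.QuantumManyBody.BoseGas.sideLength ρ N), Literature.MathematicalPhysics.QuantumManyBody.BoseGas.energy v Ψ ≤ Literature.MathematicalPhysics.QuantumManyBody.BoseGas.groundStateEnergy v N (Literature.MathematicalPhysics.QuantumManyBody.BoseGas.sideLength ρ N) + δ → ∀ k : Fin 3 → ℤ, k ≠ 0 → Literature.MathematicalPhysics.QuantumManyBody.BoseGas.occupation N ((Literature.MathematicalPhysics.QuantumManyBody.BoseGas.box (Literature.MathematicalPhysics.QuantumManyBody.BoseGas.sideLength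 ρ N)).indicator fun x => ((Real.sqrt (Literature.MathematicalPhysics.QuantumManyBody.BoseGas.sideLength ρ N ^ 3))⁻¹ : ℂ) * Complex.exp (Complex.I * (2 * Real.pi / Literature.MathematicalPhysics.QuantumManyBody.BoseGas.sideLength ρ N * ∑ j, (k j : ℝ) * x j : ℝ))) Ψ.ψ ≤ ENNReal.ofReal (C * (Real.sqrt ρ * Literature.MathematicalPhysics.QuantumManyBody.BoseGas.sideLength ρ N / ‖(fun j => (k j : ℝ))‖ + ρ ^ 2 * Literature.MathematicalPhysics.QuantumManyBody.BoseGas.sideLength ρ N ^ 4 / ‖(fun j => (k j : ℝ))‖ ^ 4))) → (∀ v : ℝ → ℝ≥0∞, Literature.MathematicalPhysics.QuantumManyBody.BoseGas.IsRepulsiveFiniteRange v → ∃ ρ₀ : ℝ, 0 < ρ₀ ∧ ∀ ρ : ℝ, 0 < ρ → ρ < ρ₀ → ∃ c : ℝ, 0 < c ∧ ∀ᶠ N : ℕ in Filter.atTop, ∃ δ : ℝ≥0∞, 0 < δ ∧ ∀ Ψ : Literature.MathematicalPhysics.QuantumManyBody.BoseGas.TrialState N (Literature.MathematicalPhysics.QuantumManyBody.BoseGas.sideLength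 ρ N), Literature.MathematicalPhysics.QuantumManyBody.BoseGas.energy v Ψ ≤ Literature.MathematicalPhysics.QuantumManyBody.BoseGas.groundStateEnergy v N (Literature.MathematicalPhysics.QuantumManyBody.BoseGas.sideLength ρ N) + δ → ENNReal.ofReal (c * N) ≤ Literature.MathematicalPhysics.QuantumManyBody.BoseGas.occupation N ((Literature.MathematicalPhysics.QuantumManyBody.BoseGas.box (Literature.MathematicalPhysics.QuantumManyBody.BoseGas.sideLength ρ N)).indicator fun _ => ((Real.sqrt (Literature.MathematicalPhysics.QuantumManyBody.BoseGas.sideLength ρ N ^ 3))⁻¹ : ℂ)) Ψ.ψ)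

/-- item stmt-AtomisticToContinuum-0735 · support · rank 3 · open · by planner
why it might fail: SUPERSEDED — do not claim: hypothesis 1 is BecIrBoundInner (0733) verbatim, false as typed (v ≡ 0 admitted; sharp-window k⁻⁴ branch), so it is vacuous; replaced by BecWindowCount/BecDepletionSplit/BecDepletionCounting. Not a hypothesis of `closes`.
sources: LSSY2005, refuter notes g12-5/g15-5/g24-0 on stmt-AtomisticToContinuum-0733
MODE COUNTING, INNER-BOX FORM (supersedes stmt-AtomisticToContinuum-0690): (inner-box IR bound, stmt
bec_ir_bound_inner) → (shell bound, stmt bec_shell_mass) → X_B1 (stmt-0686 verbatim). Proof: fix ε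
small. (1) Parseval on Λ' for the ONB (φ'_k)_{k∈ℤ³} of L²(Λ') applied to x ↦ Ψ(x,Y): Σ_k
⟨φ'_k,γφ'_k⟩ = tr(1_{Λ'}γ) = N − N_shell ≥ N(1 − Cε). (2) Lattice sum Σ_{k≠0} min(√ρL/|k|,
ρ²L⁴/|k|⁴) ≤ C₁ρ^{3/2}L³ = C₁N√ρ (split at |k| ≈ √ρL), so ⟨φ'_0,γφ'_0⟩ ≥ N(1 − Cε − CC₁√ρ). (3) φ₀ =
L^{-3/2}1_Λ = (1−2ε)^{3/2}φ'_0 + w, w = L^{-3/2}1_shell, ‖w‖² ≤ 6ε; γ ≥ 0 gives ⟨φ₀,γφ₀⟩ ≥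
((1−2ε)^{3/2}⟨φ'_0,γφ'_0⟩^{1/2} − ⟨w,γw⟩^{1/2})² and ⟨w,γw⟩ ≤ ‖w‖²·tr(1_shell γ) ≤ 6ε·CεN
(Cauchy–Schwarz in x over the shell inside ). (4) Choose ε, then ρ₀' ≤ ρ₀(ε) with CC₁√ρ₀' small:
⟨φ₀,γφ₀⟩ ≥ N/2, c = 1/2, same δ (take min of the two δ's). TRUE and provable in principle;
Lean-heavy parts: 3-D Fourier series/Parseval on a cube (Mathlib has AddCircle 1-D), tsum–lintegral
interchange, the lattice-sum estimate. -/
@[route_item "route-AtomisticToContinuum-BECInfraredBound"]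
def BecIrInnerImpliesZeroMode : Prop :=
  (∀ v : ℝ → ENNReal, Literature.MathematicalPhysics.QuantumManyBody.BoseGas.IsRepulsiveFiniteRange v → ∀ ε : ℝ, 0 < ε → ε < 1 / 4 → ∃ ρ₀ : ℝ, 0 < ρ₀ ∧ ∃ C : ℝ, 0 < C ∧ ∀ ρ : ℝ, 0 < ρ → ρ < ρ₀ → ∀ᶠ N : ℕ in Filter.atTop, ∃ δ : ENNReal, 0 < δ ∧ ∀ Ψ : Literature.MathematicalPhysics.QuantumManyBody.BoseGas.TrialState N (Literature.MathematicalPhysics.QuantumManyBody.BoseGas.sideLength ρ N), Literature.MathematicalPhysics.QuantumManyBody.BoseGas.energy v Ψ ≤ Literature.MathematicalPhysics.QuantumManyBody.BoseGas.groundStateEnergy v N (Literature.MathematicalPhysics.QuantumManyBody.BoseGas.sideLength ρ N) + δ → ∀ k : Fin 3 → ℤ, k ≠ 0 → Literature.MathematicalPhysics.QuantumManyBody.BoseGas.occupation N ({x : EuclideanSpace ℝ (Fin 3) | ∀ j, x j ∈ Set.Ioo (ε * Literature.MathematicalPhysics.QuantumManyBody.BoseGas.sideLength ρ N) (Literature.MathematicalPhysics.QuantumManyBody.BoseGas.sideLength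 ρ N - ε * Literature.MathematicalPhysics.QuantumManyBody.BoseGas.sideLength ρ N)}.indicator fun x => ((Real.sqrt (((1 - 2 * ε) * Literature.MathematicalPhysics.QuantumManyBody.BoseGas.sideLength ρ N) ^ 3))⁻¹ : ℂ) * Complex.exp (Complex.I * ↑(2 * Real.pi / ((1 - 2 * ε) * Literature.MathematicalPhysics.QuantumManyBody.BoseGas.sideLength ρ N) * ∑ j, (k j : ℝ) * x j))) Ψ.ψ ≤ ENNReal.ofReal (C * min (Real.sqrt ρ * Literature.MathematicalPhysics.QuantumManyBody.BoseGas.sideLength ρ N / ‖(fun j => (k j : ℝ))‖) (ρ ^ 2 * Literature.MathematicalPhysics.QuantumManyBody.BoseGas.sideLength ρ N ^ 4 / ‖(fun j => (k j : ℝ))‖ ^ 4))) → (∀ v : ℝ → ENNReal, Literature.MathematicalPhysics.QuantumManyBody.BoseGas.IsRepulsiveFiniteRange v → ∃ C : ℝ, 0 < C ∧ ∀ ε : ℝ, 0 < ε → ε < 1 / 4 → ∃ ρ₀ : ℝ, 0 < ρ₀ ∧ ∀ ρ : ℝ, 0 < ρ → ρ < ρ₀ → ∀ᶠ N : ℕ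 in Filter.atTop, ∃ δ : ENNReal, 0 < δ ∧ ∀ Ψ : Literature.MathematicalPhysics.QuantumManyBody.BoseGas.TrialState N (Literature.MathematicalPhysics.QuantumManyBody.BoseGas.sideLength ρ N), Literature.MathematicalPhysics.QuantumManyBody.BoseGas.energy v Ψ ≤ Literature.MathematicalPhysics.QuantumManyBody.BoseGas.groundStateEnergy v N (Literature.MathematicalPhysics.QuantumManyBody.BoseGas.sideLength ρ N) + δ → ∑ i : Fin N, ∫⁻ X, {x : EuclideanSpace ℝ (Fin 3) | ∀ j, x j ∈ Set.Ioo (ε * Literature.MathematicalPhysics.QuantumManyBody.BoseGas.sideLength ρ N) (Literature.MathematicalPhysics.QuantumManyBody.BoseGas.sideLength ρ N - ε * Literature.MathematicalPhysics.QuantumManyBody.BoseGas.sideLength ρ N)}ᶜ.indicator (fun _ => (1 : ENNReal)) (X i) * (‖Ψ.ψ X‖₊ : ENNReal) ^ 2 ≤ ENNReal.ofReal (C * ε * N)) → (∀ v : ℝ → ENNReal, Literature.MathematicalPhysics.QuantumManyBody.BoseGas.IsRepulsiveFiniteRange v → ∃ ρ₀ : ℝ, 0 < ρ₀ ∧ ∀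 ρ : ℝ, 0 < ρ → ρ < ρ₀ → ∃ c : ℝ, 0 < c ∧ ∀ᶠ N : ℕ in Filter.atTop, ∃ δ : ENNReal, 0 < δ ∧ ∀ Ψ : Literature.MathematicalPhysics.QuantumManyBody.BoseGas.TrialState N (Literature.MathematicalPhysics.QuantumManyBody.BoseGas.sideLength ρ N), Literature.MathematicalPhysics.QuantumManyBody.BoseGas.energy v Ψ ≤ Literature.MathematicalPhysics.QuantumManyBody.BoseGas.groundStateEnergy v N (Literature.MathematicalPhysics.QuantumManyBody.BoseGas.sideLength ρ N) + δ → ENNReal.ofReal (c * N) ≤ Literature.MathematicalPhysics.QuantumManyBody.BoseGas.occupation N ((Literature.MathematicalPhysics.QuantumManyBody.BoseGas.box (Literature.MathematicalPhysics.QuantumManyBody.BoseGas.sideLength ρ N)).indicator fun _ => ((Real.sqrt (Literature.MathematicalPhysics.QuantumManyBody.BoseGas.sideLength ρ N ^ 3))⁻¹ : ℂ)) Ψ.ψ)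

/-- item stmt-AtomisticToContinuum-0691 · support · rank 5 · open · by planner
why it might fail: NOT A ROUTE OBLIGATION — do not claim: the body is the named Literature fact Fournais2020_condensation (Fournais2020 Thm 1.2, periodic boxes at GP-plus scales, L¹ potentials), a citation request now vendored; its localised use belongs inside BecUvTail's proof. Not in `closes`.
sources: Fournais2020, arXiv:2011.00309
LITERATURE FACT wanted as hypothesis (cite, not claim): BEC on mesoscopic length scales — for the
dilute 3-D Bose gas with repulsive finite-range v (scattering length a), in boxes of side ℓ with
ρ^{-1/2}a^{-1/2} ≪ ℓ ≤ ρ^{-1/2}a^{-1/2}(ρa³)^{-η} (some η > 0), states with energy ≤ LHY order have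
condensate fraction 1 − O((ρa³)^{κ}) in the constant mode of the box (Fournais, arXiv:2011.00309,
main theorem; built on Fournais–Solovej arXiv:1904.06164). To be vendored as a named def Prop and
used as (h : …) in crux 2's high-momentum half. -/
@[route_item "route-AtomisticToContinuum-BECInfraredBound"]
def BecFournaisLengthScales : Prop :=
  Literature.MathematicalPhysics.QuantumManyBody.BoseGas.Fournais2020_condensation

-- TODO item stmt-AtomisticToContinuum-14181 · support · rank 9 · open · by planner — BLOCKED: missing decl(s) BecDepletionCounting, BecDepletionSplit, BecFreeGas, BecWindowCount; restate via `ledger route edit` once they land: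
--   def BecZeroModeGlue : Prop := BecIrWindow → BecUvTail → BecShellMass → BecWindowCount → BecDepletionSplit → BecDepletionCounting → BecFreeGas → BecZeroModeThesis

/-- item stmt-AtomisticToContinuum-14463 · support · rank 9 · open · by planner
why it might fail: Derived lemma (target by name): BecIrWindow → BecUvTail → BecShellMass → BecZeroModeThesis; pure logic from BecWindowCount/BecDepletionSplit/BecDepletionCounting/BecFreeGas once those are PROVED (recipe: evidence Sketch2.lean) — claim only then; no independent risk.
sources: LSSY2005, DysonLiebSimon1978, planner Sketch2.lean (evidence on stmt-AtomisticToContinuum-14463)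
[support] GLUE TO THE TARGET, thesis form (route-choice repair 2026-08-16; operator hold
`target-unreachable` on BecZeroModeThesis): the two cruxes and no-boundary-accumulation imply X_B1
BY NAME — BecIrWindow → BecUvTail → BecShellMass → BecZeroModeThesis. This is literally THE LINE of
the thesis: (i) window infrared bound + (ii) summed ultraviolet tail + (iii) shell mass ⇒ zero-mode
macroscopic occupation (the free gas v a.e. 0 being settled inside by BecFreeGas). PROOF = pure
logic from the four rank-9 counting supports once they are proved (planner Sketch2.lean, rc 0
against rev 7, attached as evidence): `fun hIr hUv hSh v hv => by_cases hae : (∀ᵐ r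
∂(volume.restrict (Ioi 0)), v r = 0); · exact BecFreeGas_holds v hv hae; · exact
BecDepletionCounting_holds v hv (BecDepletionSplit_holds v hv (BecWindowCount_holds v hv (hIr v hv
hae)) (hUv v hv)) (hSh v hv)`. PROVE IT LAST: claim only after BecWindowCount (stmt-9015),
BecDepletionSplit (stmt-9026), BecDepletionCounting (stmt-9034) and BecFreeGas (stmt-8912) have
landed — else release `blocked-on: upstream:<the open one>`; re-deriving the mode counting inside
this item would duplicate those supports. Why this form: items render by -/
@[route_item "route-AtomisticToContinuum-BECInfraredBound"]
def BecZeroModeOfCruxes : Prop :=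
  BecIrWindow → BecUvTail → BecShellMass → BecZeroModeThesis

/-- item stmt-AtomisticToContinuum-0687 · assembly · rank 1 · closed · proved by AtomisticToContinuum.BECRenormGroup.bec_of_zeroMode_rg (refuter) · by planner
X_B1 → BoseEinsteinCondensation: occupation of φ₀ ≤ maxOccupation (occupation_le_maxOccupation, φ₀
measurable and L²-normalised for L > 0), uniform over δ-near-minimisers ⇒ ≤ condensateNumber
(le_condensateNumber) ⇒ HasGroundStateBEC v ρ. -/
@[route_item "route-AtomisticToContinuum-BECInfraredBound"]
def Assembly : Prop :=
  (∀ v : ℝ → ENNReal, Literature.MathematicalPhysics.QuantumManyBody.BoseGas.IsRepulsiveFiniteRange v → ∃ ρ₀ : ℝ, 0 < ρ₀ ∧ ∀ ρ : ℝ, 0 < ρ → ρ < ρ₀ → ∃ c : ℝ, 0 < c ∧ ∀ᶠ N : ℕ in Filter.atTop, ∃ δ : ENNReal, 0 < δ ∧ ∀ Ψ : Literature.MathematicalPhysics.QuantumManyBody.BoseGas.TrialState N (Literature.MathematicalPhysics.QuantumManyBody.BoseGas.sideLength ρ N), Literature.MathematicalPhysics.QuantumManyBody.BoseGas.energy v Ψ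 ≤ Literature.MathematicalPhysics.QuantumManyBody.BoseGas.groundStateEnergy v N (Literature.MathematicalPhysics.QuantumManyBody.BoseGas.sideLength ρ N) + δ → ENNReal.ofReal (c * N) ≤ Literature.MathematicalPhysics.QuantumManyBody.BoseGas.occupation N ((Literature.MathematicalPhysics.QuantumManyBody.BoseGas.box (Literature.MathematicalPhysics.QuantumManyBody.BoseGas.sideLength ρ N)).indicator fun _ => ((Real.sqrt (Literature.MathematicalPhysics.QuantumManyBody.BoseGas.sideLength ρ N ^ 3))⁻¹ : ℂ)) Ψ.ψ) → Literature.MathematicalPhysics.QuantumManyBody.BoseGas.BoseEinsteinCondensation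

/-- `Assembly` holds: proved by `AtomisticToContinuum.BECRenormGroup.bec_of_zeroMode_rg`. -/
theorem Assembly_holds : Assembly := _root_.AtomisticToContinuum.BECRenormGroup.bec_of_zeroMode_rg

-- records of items no longer active in this route (dropped / restated):
-- earlier Assembly2 (stmt-AtomisticToContinuum-0688, dropped 2026-08-16T14:43:06Z): moot by None — BecIrWindow → BecUvTail → BecShellMass → BecWindowCount → BecDepletionSplit → BecDepletionCounting → BecFreeGas → BoseEinsteinCondensation

/-! D-0027 §2.1 — DECIDING THEOREM (planner-authored via `route open/edit --closes-file`; by planner-rbadge-AtomisticToContinuum-BECInfrare-86e96d06-g3-0 2026-08-16T06:55:09Z):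
its hypotheses are this route's items and its conclusion the sub-problem Statement (glue_lint), and it elaborates with this file. -/

/-- Deciding theorem (D-0027 §2.1), crux-only (ruling 2026-08-16), pure logic. Hypotheses = the
seven cruxes. For each admissible `v`, split on whether `v` is a.e. zero on `(0,∞)`: if so, the
crux `BecFreeGas` gives X_B1 for `v` directly (free Dirichlet gas); if not, `BecIrWindow` supplies
the window infrared bound for `v`, `BecWindowCount` turns it into an `ηN` window count,
`BecDepletionSplit` adds the ultraviolet tail `BecUvTail` to get inner-box depletion `≤ θ'N`, and
`BecDepletionCounting` with the shell bound `BecShellMass` yields X_B1 (`BecZeroModeThesis`) for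
`v`. Finally the PROVED assembly `Assembly_holds` (`bec_of_zeroMode_rg`: occupation of the
constant mode ≤ λ_max ≤ condensateNumber) gives the conjunct. As the draft-phase cruxes land,
rewrite with their `_holds` theorems (target shape: `closes : BecIrWindow → BoseEinsteinCondensation`). -/
@[closes "route-AtomisticToContinuum-BECInfraredBound"] theorem closes : BecIrWindow → BecUvTail → BecShellMass → BecWindowCount → BecDepletionSplit → BecDepletionCounting → BecFreeGas → BoseEinsteinCondensation := by
  intro hIr hUv hSh hW hD hC hF
  refine Assembly_holds ?_
  intro v hv
  by_cases hae : (∀ᵐ r ∂(MeasureTheory.volume.restrict (Set.Ioi (0 : ℝ))), v r = 0)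
  · exact hF v hv hae
  · exact hC v hv (hD v hv (hW v hv (hIr v hv hae)) (hUv v hv)) (hSh v hv)

end Summit.AtomisticToContinuum.BoseEinsteinCondensation.Theses.BECInfraredBound
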